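import Summits.SmoothPoincare4.SmoothPoincare4.Statement
import HarnessLib

/-!
# SmoothPoincare4 — summit statement (D-0017)

Single-conjunct summit: the statement `SmoothPoincare4` is defined in `Summits/SmoothPoincare4/SmoothPoincare4/Statement.lean` (moved verbatim,
declaration names unchanged); this file re-exports it by import.
-/
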